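import Summits.ResolutionOfSingularities.ResolutionOfSingularities.Theorems.WildConesCampaignW46ThreefoldsCharTwo

/-!
# [OURS · L1 W4.6, rung (ii) at p = 2] One-variable bookkeeping in characteristic two: the Milnor algebra
# `κ⟦X⟧/(f')` — non-vanishing, `μ = ord f'`, `(f') = (X^μ)`, EVEN `μ`, and forward transfer of
# finiteness along `a = X² G`

Cell res-hironaka (LADDER-RESOLUTION rung L, D-0089), slot W4.6, seat res-L1-s46-pv-4 (gen 2); host route
`WildCones`, crux `ClassicalRegimes` (stmt-ResolutionOfSingularities-16884). First of three files
(`…CharTwoCurveLeaf`, `…CharTwoSplittingRegime`, `…CharTwoResolution`) on the HYPERBOLIC-SPLITTING REGIME of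
threefold hypersurface double points `z² = a(u₀,u₁,u₂)` in characteristic `2`: the tree's blow-up-free
descent (`WildCones.MuDropCharTwoOrdP.pair_reduction` + `descent`) and its blow-up-compatible form
(`descent_step`) reduce every question about the Milnor algebra of an order-2-cleaned double point, and of
its strict transform, to ONE variable; this file is the one-variable end of that reduction.

HONEST FRAMING. Everything here is OURS and elementary (power series in one variable over a field):
nothing is a statement of H. Hironaka's manuscript [Hironaka2017], no FACT-LIST premise is used. The two
facts that drive the sequel: in characteristic two `f' = Σ_{k odd} f_k X^{k-1}` has only EVEN-degree
terms, so a finite Milnor number `dim_κ κ⟦X⟧/(f') = ord f'` is EVEN (`curve_milnor_even`); and the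
one-variable blow-up relation `a = X² G` gives `a' = X² G'`, so finiteness of `κ⟦X⟧/(a')` transfers
FORWARD to `κ⟦X⟧/(G')` (`curve_finite_strict`; the tree's `curve_drop`/`curve_drop_eq` assume the latter).
AI review is weaker than expert review.

Decls (namespace `…Theorems.CampaignW46.ThreefoldsCharTwo`): `range_pderiv_fin_one`,
`pderiv_ne_zero_of_finite`, `finrank_eq_order_pderiv`, `curve_span_pderiv_eq_span_X_pow`,
`coeff_pderiv_eq_zero_of_odd`, `even_order_pderiv`, `curve_milnor_even`, `curve_finite_strict`.
-/

noncomputable section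

-- single-problem summit: the doubled namespace component `ResolutionOfSingularities` is forced
set_option linter.dupNamespace false

open scoped BigOperators Classical

open MvPowerSeries

open Literature.AlgebraicGeometry.Resolution

namespace Summit.ResolutionOfSingularities.ResolutionOfSingularities.Theorems

namespace CampaignW46.ThreefoldsCharTwo

open WildCones WildCones.MuDropCharTwoOrdP

variable {κ : Type} [Field κ]

/-! ## One variable: the Milnor algebra `κ⟦X⟧/(a')` in characteristic two -/

/-- [OURS · L1 W4.6] In one variable the gradient ideal is principal: `(∂ₛ f)_s = {∂₀ f}`. [folklore] -/
theorem range_pderiv_fin_one (f : MvPowerSeries (Fin 1) κ) :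
    (Set.range fun s => MvPowerSeries.pderiv s f) = {MvPowerSeries.pderiv 0 f} := by
  ext x
  simp only [Set.mem_range, Set.mem_singleton_iff]
  exact ⟨fun ⟨s, hs⟩ => by rw [← hs, Subsingleton.elim s 0], fun h => ⟨0, h.symm⟩⟩

/-- [OURS · L1 W4.6] In one variable a finite Milnor algebra `κ⟦X⟧/(f')` forces `f' ≠ 0` (the zero
ideal has the infinite quotient `κ⟦X⟧`). [folklore] -/
theorem pderiv_ne_zero_of_finite {f : MvPowerSeries (Fin 1) κ}
    (hfin : Module.Finite κ (MvPowerSeries (Fin 1) κ ⧸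
      Ideal.span (Set.range fun s => MvPowerSeries.pderiv s f))) :
    MvPowerSeries.pderiv 0 f ≠ 0 := by
  intro h0
  rw [range_pderiv_fin_one, h0, Ideal.span_singleton_zero] at hfin
  refine not_finite_quot_span (n := 1) (κ := κ) ∅ (by simp) (by simp) ?_
  rwa [Finset.coe_empty, Ideal.span_empty]

/-- [OURS · L1 W4.6] In one variable the Milnor number is the order of the derivative:
`dim_κ κ⟦X⟧/(f') = ord f'`. [folklore] -/
theorem finrank_eq_order_pderiv {f : MvPowerSeries (Fin 1) κ}
    (hfin : Module.Finite κ (MvPowerSeries (Fin 1) κ ⧸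
      Ideal.span (Set.range fun s => MvPowerSeries.pderiv s f))) :
    Module.finrank κ (MvPowerSeries (Fin 1) κ ⧸
        Ideal.span (Set.range fun s => MvPowerSeries.pderiv s f)) =
      (MvPowerSeries.pderiv 0 f).order.toNat := by
  have h := pderiv_ne_zero_of_finite hfin
  rw [range_pderiv_fin_one]
  exact (finrank_quot_span_singleton h).2

/-- [OURS · L1 W4.6] In one variable the gradient ideal of a series with finite Milnor algebra is
`(X^μ)`, `μ = dim_κ κ⟦X⟧/(f')`. [folklore] -/
theorem curve_span_pderiv_eq_span_X_pow {f : MvPowerSeries (Fin 1) κ}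
    (hfin : Module.Finite κ (MvPowerSeries (Fin 1) κ ⧸
      Ideal.span (Set.range fun s => MvPowerSeries.pderiv s f))) :
    Ideal.span (Set.range fun s => MvPowerSeries.pderiv s f) =
      Ideal.span {(X 0 : MvPowerSeries (Fin 1) κ) ^ Module.finrank κ (MvPowerSeries (Fin 1) κ ⧸
        Ideal.span (Set.range fun s => MvPowerSeries.pderiv s f))} := by
  have h := pderiv_ne_zero_of_finite hfin
  rw [finrank_eq_order_pderiv hfin, range_pderiv_fin_one]
  obtain ⟨u, hu, hgu⟩ := exists_eq_X_pow_mul_unit h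
  conv_lhs => rw [hgu]
  exact Ideal.span_singleton_mul_right_unit hu _

/-- [OURS · L1 W4.6] **Characteristic two: a derivative has no odd-degree terms** — the coefficient of
`X^k` in `f'` is `(k + 1) f_{k+1}`, which vanishes for odd `k`. [folklore] -/
theorem coeff_pderiv_eq_zero_of_odd [CharP κ 2] (f : MvPowerSeries (Fin 1) κ) {k : ℕ} (hk : Odd k) :
    coeff (Finsupp.single 0 k) (MvPowerSeries.pderiv 0 f) = 0 := by
  rw [MvPowerSeries.coeff_pderiv, Finsupp.single_eq_same]
  have h2 : ((k : κ) + 1) = 0 := by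
    have h : ((k : κ) + 1) = ((k + 1 : ℕ) : κ) := by push_cast; ring
    rw [h, CharP.cast_eq_zero_iff κ 2]
    exact (hk.add_one).two_dvd
  rw [h2, zero_mul]

/-- [OURS · L1 W4.6] **Characteristic two: a non-zero derivative has EVEN order.** [folklore] -/
theorem even_order_pderiv [CharP κ 2] {f : MvPowerSeries (Fin 1) κ}
    (h : MvPowerSeries.pderiv 0 f ≠ 0) : Even (MvPowerSeries.pderiv 0 f).order.toNat := by
  have hfinite := ne_zero_iff_order_finite.mp h
  obtain ⟨d, hd, hdeg⟩ := exists_coeff_ne_zero_and_order hfinite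
  have hd1 : d = Finsupp.single 0 (d 0) := Finsupp.ext fun s => by
    rw [Subsingleton.elim s 0, Finsupp.single_eq_same]
  have hdeg1 : d.degree = d 0 := by
    rw [degree_eq_sum_univ, Fin.sum_univ_one]
  have hord : (MvPowerSeries.pderiv 0 f).order.toNat = d 0 := by
    have : (((MvPowerSeries.pderiv 0 f).order.toNat : ℕ) : ℕ∞) = ((d 0 : ℕ) : ℕ∞) := by
      rw [hfinite, ← hdeg, hdeg1]
    exact_mod_cast this
  rw [hord]
  by_contra hodd
  rw [Nat.not_even_iff_odd] at hodd
  apply hd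
  rw [hd1]
  exact coeff_pderiv_eq_zero_of_odd f hodd

/-- [OURS · L1 W4.6] **In one variable and characteristic two a finite Milnor number is EVEN**:
`dim_κ κ⟦X⟧/(f') = ord f' ∈ 2ℕ`. [folklore] -/
theorem curve_milnor_even [CharP κ 2] {f : MvPowerSeries (Fin 1) κ}
    (hfin : Module.Finite κ (MvPowerSeries (Fin 1) κ ⧸
      Ideal.span (Set.range fun s => MvPowerSeries.pderiv s f))) :
    Even (Module.finrank κ (MvPowerSeries (Fin 1) κ ⧸
      Ideal.span (Set.range fun s => MvPowerSeries.pderiv s f))) := by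
  rw [finrank_eq_order_pderiv hfin]
  exact even_order_pderiv (pderiv_ne_zero_of_finite hfin)

/-- [OURS · L1 W4.6] **The curve leaf transfers isolatedness FORWARD**: in one variable and
characteristic two, if `X² G = a` (the blow-up relation in one variable) and `κ⟦X⟧/(a')` is finite then
so is `κ⟦X⟧/(G')` — `a' = X² G'`, so `G' ≠ 0`. (The tree's `curve_drop`/`curve_drop_eq` assume the
finiteness of `G`; here it is derived.) [folklore] -/
theorem curve_finite_strict [CharP κ 2] (i : Fin 1) (τ : Fin 1 → κ) {a G : MvPowerSeries (Fin 1) κ}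
    (hG : X i ^ 2 * G = subst (fun s => if s = i then (X i : MvPowerSeries (Fin 1) κ)
      else X i * (X s + C (τ s))) a)
    (hfin : Module.Finite κ (MvPowerSeries (Fin 1) κ ⧸
      Ideal.span (Set.range fun s => MvPowerSeries.pderiv s a))) :
    Module.Finite κ (MvPowerSeries (Fin 1) κ ⧸
      Ideal.span (Set.range fun s => MvPowerSeries.pderiv s G)) := by
  have hi : i = 0 := Subsingleton.elim _ _
  subst hi
  have hφ : (fun s => if s = (0 : Fin 1) then (X 0 : MvPowerSeries (Fin 1) κ)
      else X 0 * (X s + C (τ s))) = X := by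
    funext s; rw [Subsingleton.elim s 0, if_pos rfl]
  rw [hφ, subst_self, id] at hG
  have ha := pderiv_ne_zero_of_finite hfin
  have hda : MvPowerSeries.pderiv 0 a = X 0 ^ 2 * MvPowerSeries.pderiv 0 G := by
    rw [← hG, pderiv_X_sq_mul]
  have hg : MvPowerSeries.pderiv 0 G ≠ 0 := fun h0 => ha (by rw [hda, h0, mul_zero])
  rw [range_pderiv_fin_one]
  exact (finrank_quot_span_singleton hg).1

end CampaignW46.ThreefoldsCharTwo

end Summit.ResolutionOfSingularities.ResolutionOfSingularities.Theorems

end
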